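import Summits.HodgeConjecture.HodgeConjecture.Theorems.Ring2DeformAndreRebasedRows
import Summits.HodgeConjecture.CorCM.AndreWeakFormOfRiemann
import HarnessLib

/-!
# Ring 2 · route `deform`, XXI — the ANDRÉ-1992 rows of parts I / III / XIV / XIX modulo RIEMANN'S THEOREM:
# André's record DISCHARGED by the tree (cell `pub-hodgecm2`) from `DeligneMilne1982_Thm_6_20_full`, and — by the
# field-only form of that discharge — Deligne's tensor-anchored Weil families (Thm. 4.8) MOOT on the deformation axis

HONEST FRAMING: research route conditional on HC_CM; not a corollary; Q11.4-sentence-2 already refuted in dim ≥ 3.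

Cell `pub-hodge-ring2`, seat `pub-hodge-ring2-deform` (gen 73; revs 2–3 = docstring-only, gen 85), supporting the OPEN
item `CMToAbelian` (stmt-HodgeConjecture-16267; nothing here closes it). `HC_CM` := the binder
`Theses.RankFourFaces.CMAbelianHodge`
(always an argument, never a fact; `= CorCM.HC_CM` by `rfl`, cell pub-hodgecm2 `CorCM/Interfaces.lean`);
`HC_AV` := `Theses.PadicSemiregularLift.HodgeAbelianVarieties`.

WHY THIS PART (standing rule D.163 (β) of the seat: "a landed `DeligneMilne1982_Thm_6_20_full → [André 1992]`").
Eleven rows of the deformation axis — I (D) (M) (E₂) (E₃), III row M (×2), XIV §A §B §P (×2), XIX §3 — reach `HC_CM`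
from a deformation input through the FIELD-typed Weil rungs R∞ / R3 of the Weil-type ladder and therefore bind
André's 1992 theorem as the named Literature record
`h𝔄 : HodgeTheory.Andre1992_hodgeClasses_cmAbelianVariety_mem_span_pullback_weilClasses` (André 1992 Théorème =
Charles–Schnell Thm. 11.5.21 = Milne's endnote M.12). Cell `pub-hodgecm2` has now DERIVED that record in the kernel
from Riemann's theorem alone: `CorCM.AndreWeakForm.andre1992_weak_of_riemann : DeligneMilne1982_Thm_6_20_full → [André
1992]` (`CorCM/AndreWeakFormOfRiemann.lean`; assembly `andre1992_weak_of_domination` = André's trick on CM-typed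
products descended along a retraction, fed with `CorCM.AndreRiemann.exists_avDominatedBy_biproduct_realisations_of_riemann'`
= Poincaré reducibility + Shimura §5.1 from Riemann's theorem, inflation to a common Galois CM field of degree `> 2`).
This part threads that arrow through the deformation axis's rows (§1), and then uses the SHARPER form the same file
proves — `CorCM.AndreWeakForm.andre1992_weakField_of_riemann`: only Weil classes of CM FIELDS OF DEGREE `e > 2` are
needed, never the imaginary-quadratic member, whence `CorCM.AndreWeakForm.hc_cm_of_riemann_of_weilClassesCMField :
hR → R3 → HC_CM` — to drop Deligne's tensor-anchored Weil families `hD : deligne1982_weilFamily_hodgeWeilSection_all`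
(LNM 900 Thm. 4.8, `e = 2`; a Literature record) from the deformation axis's OWN rows (§2): the rung R∞
`WeilClassesImaginaryQuadratic`, which `hD` was there to produce, is no longer consumed. Ledger, row by row (binders
other than the deformation input; `hR : DeligneMilne1982_Thm_6_20_full`, R3anc = hweil's OPEN anchored leaf
`AnchoredWeilFamiliesCMField`):

* I (D)   `HC_CM_of_abelianSchemeVHC`        [h𝔄, hD, R3anc]             ↦ §1 [hR, hD, R3anc]       ↦ §2 (D″)  [hR, R3anc]
* I (M)   `HC_AV_of_abelianSchemeVHC`        [h𝔄, hD, R3anc, MTAnchors]  ↦ §1 [hR, hD, R3anc, MTA.]  ↦ §2 (M″)  [hR, R3anc, MTA.]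
* I (E₂)  `HC_AV_iff_abelianSchemeVHC`       [h𝔄, hD, R3anc, MTAnchors]  ↦ §1                        ↦ §2 (E₂″) [hR, R3anc, MTA.]
* I (E₃)  `HC_CM_and_abelianSchemeVHC_iff`   [h𝔄, hD, R3anc]             ↦ §1                        ↦ §2 (E₃″) [hR, R3anc]
* III M   `…_of_deligne1982` (×2)            [h𝔄, hD, R3anc, h₁₄]        ↦ §1                        ↦ §2       [hR, R3anc, h₁₄]
* XIV §A  `cmIdle_abelianSchemeVHC_of_milne`, §P `pivotAV_abelianSchemeVHC_of_milne` [h𝔄, hD, R3anc, h₁₄] ↦ §1 ↦ §2 [hR, R3anc, h₁₄]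
* XIV §B  `cmIdle_invariantCyclesOnMTFamilies_…`, §P `pivotAV_invariantCyclesOnMTFamilies_…` [AO⁺, hF, h𝔄, DA_q, DA_K]
          ↦ §1 [AO⁺, hF, hR, DA_q, DA_K] only (these thread `h𝔄` into spread-1's `AbelianAll.cmIdle_spreadZD`; dropping
          DA_q there is spread-1's re-base of ITS arrow — count once — and is not written here)
* XIX §3  `denselyAnchoredEigen_of_andre_of_rungInputs_of_abelianSchemeVHC` [hF, h𝔄, hD, R3anc] ↦ §1 ↦ §2 [hF, hR, R3anc]

COUNT ONCE. `hR ⟹ [André 1992]`, its field-only form and `hR ⟹ (R3 ⟹ HC_CM)` are cell pub-hodgecm2's theorems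
(literature seat André: `CorCM/AndreWeakFormOfRiemann.lean`, `…OfDomination.lean`, `AndreProductForm*`; seat b24:
`CorCM/AndreRiemann*`); `R3anc ∧ (1) ⟹ R3` is part I; (V) `HC_CM → MTAnchors → (1) → HC_AV` is part I; the frame
vocabulary is spread-1's / typer2's. New here is ONLY the threading through the deformation axis's rows; every proof is
a composition BY NAME (no adapter: `CorCM.HC_CM` is `CMAbelianHodge` by `rfl`). Parts I / III / XIV / XIX are untouched
(append-only): their `h𝔄` rows stand as filed and are implied by the rows below.

HONEST COLUMN. The KIND of every row is unchanged (open-leaf-conditional: R3anc, (1) `AbelianSchemeVHC`, IC_MT, DA_q /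
DA_K, AO⁺ are OPEN nodes exactly as before). What changed is the FACT LEDGER: André 1992 is DISCHARGED MODULO
RIEMANN'S THEOREM — `hR` is the Literature record of a THEOREM IN PRINT (Deligne–Milne 1982 Thm. 6.20, fullness of
`H¹_B`; the one displayed record B02 of cell pub-hodgecm2, shared tree-wide, not proved in the tree), so the rows now
read "modulo Riemann's theorem" instead of "modulo André 1992"; and in §2 Deligne's Thm. 4.8 record leaves as well:
(D″) and (E₃″) bind exactly ONE record (`hR`) and ONE open leaf (R3anc). `hR` is NOT claimed on-path (it is not a
consequence of the Hodge conjecture in the tree; it is a theorem). No case of the Hodge conjecture is proved.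

[revs 2–3, docstring-only, 2026-08-21 — rev 1's clause «not proved in the tree» (previous paragraph) is SUPERSEDED in
the tree; rev 3 only makes precise which rows become fact-free; 0 statements / 0 proofs of this file are touched.]
`DeligneMilne1982_Thm_6_20_full` is since 2026-08-21 a TREE THEOREM:
`Literature.AlgebraicGeometry.HodgeTheory.deligneMilne1982_Thm_6_20_full_holds`
(`Literature/AlgebraicGeometry/HodgeTheory/AbelianVarietyHodgeFullnessHolds.lean`, cell pub-hodgecm2 — torus
uniformisation `complexAbelianVariety_torusUniformised_holds` from
`Literature.Geometry.Kaehler.langeBirkenhake_lemma_1_1_2_weak`, Birkenhake–Lange *Complex Abelian Varieties* Ch. 1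
Lemma 1.1.2 via the exponential map, then lattice coordinates on `H¹` and GAGA for maps). Hence every `hR` binder
below is discharged by ONE-TERM APPLICATION: (D″) / (E₃″) at `…_full_holds` bind ONLY the open leaf R3anc —
`R3anc ⟹ ((1) ⟹ HC_CM)` and `R3anc ⟹ ((HC_CM ∧ (1)) ↔ (1))` — and read FACT-FREE (NO record in print left as a
hypothesis); the other rows keep exactly their non-`hR` binders as filed — (M″) / (E₂″) [R3anc, MTAnchors] (no record
either), III M and XIV §A / §P-from-(1) [R3anc, h₁₄], XIV §B / §P-from-IC_MT [AO⁺, hF, DA_q, DA_K], XIX §3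
[hF, R3anc] — `h₁₄` (Deligne Prop. 6.1 / Abdulali) and `hF` (Deligne's CM-density) being print records those rows
still bind, exactly as before; §1's literal re-bases keep `hD` too. André's record itself is now the tree theorem
`CorCM.AndreWeakForm.andre1992_hodgeClasses_cmAbelianVariety_mem_span_pullback_weilClasses_holds`
(`CorCM/AndreWeakFormHolds.lean`), so parts I / III / XIV / XIX's `h𝔄` rows are discharged AS FILED by bare
application as well, and `R3 ⟹ HC_CM` with no record is cell pub-hodgecm2's
`CorCM.Milne2020.hc_cm_of_weilClassesCMField` (`CorCM/Milne2020Holds.lean`). These one-term applications are ALIASES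
and are deliberately NOT filed as declarations (kernel-checked in the seat's scratch certificate, gen 85; axiom
closures standard); COUNT ONCE — the discharge of Riemann's theorem and of André's record is cell pub-hodgecm2's. The
KIND of every row is still open-leaf-conditional (R3anc, (1), IC_MT, DA_q / DA_K, AO⁺ OPEN); no case of the Hodge
conjecture is proved.

References (bib keys): Andre1992HodgeCM (Théorème, p. 2); DeligneMilne1982Tannakian (§6 Thm. 6.20); Deligne1982HodgeCycles
(Thm. 4.8, Prop. 6.1; Milne 2003 re-edition endnote 19); CharlesSchnell2014Notes (Thm. 11.5.21, Conj. 11.3.1, Cor.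
11.3.6); Andre1996Motifs (§6.3 Lemmes 6.3.2–6.3.3, Remarque 2); Abdulali1994FamiliesAV (Thm. 6.1 (a));
Markman2025SurveySecant (Thm. 1.4).
-/

noncomputable section

set_option linter.dupNamespace false

namespace Summit.HodgeConjecture.HodgeConjecture.Ring2.Deform

open CategoryTheory AlgebraicGeometry
open Literature.AlgebraicGeometry Literature.AlgebraicGeometry.Motives
open Literature.AlgebraicGeometry.HodgeTheory
open Literature.AlgebraicGeometry.Abdulali1994 (deligne1982_exists_cmAnchoredHodgeFamily InvariantCyclesHoldFor)
open Literature.AlgebraicGeometry.Deligne1982 (deligne1982_cmDenseMumfordTateFamilies IsCMDenseMumfordTateFamilyFor)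
open Summit.HodgeConjecture.HodgeConjecture
open Summit.HodgeConjecture.HodgeConjecture.WeilTypeLadder (AnchoredWeilFamiliesCMField WeilClassesCMField)
open Summit.HodgeConjecture.HodgeConjecture.Theses
open Summit.HodgeConjecture.HodgeConjecture.Theses.RankFourFaces (CMAbelianHodge)
open Summit.HodgeConjecture.HodgeConjecture.Theses.PadicSemiregularLift (HodgeAbelianVarieties)
open Summit.HodgeConjecture.HodgeConjecture.Ring2.Hypotheses (AbelianSchemeVHC MumfordTateCMAnchors)
open Summit.HodgeConjecture.HodgeConjecture.Ring2.AbelianAll (CMIdle PivotAV ZariskiDenseCMLocusIsDense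
  DenselyAnchoredWeilFamiliesImaginaryQuadratic DenselyAnchoredWeilFamiliesCMField DenselyAnchoredEigenWeilClassesCM
  denselyAnchoredEigen_of_deligne1982_of_HC_CM)

/-! ## §1 The eleven André-1992 rows with `h𝔄` supplied from Riemann's theorem, BY NAME -/

/-- **I (D) modulo Riemann's theorem**: blanket VHC for abelian schemes proves Hodge-for-CM, granted Deligne's
tensor-anchored Weil families, the open anchored leaf R3anc and `hR` (André's record supplied by
`CorCM.AndreWeakForm.andre1992_weak_of_riemann`). Superseded by (D″) below, kept as the literal re-base.
[cite: Andre1992HodgeCM, Théorème] [cite: DeligneMilne1982Tannakian, §6 Thm. 6.20 (Riemann)]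
[cite: Andre1996Motifs, §6.3 Lemmes 6.3.2–6.3.3 and Remarque 2] -/
theorem HC_CM_of_abelianSchemeVHC_of_riemann (hR : DeligneMilne1982_Thm_6_20_full)
    (hD : deligne1982_weilFamily_hodgeWeilSection_all) (hanc : AnchoredWeilFamiliesCMField)
    (hV : AbelianSchemeVHC) : CMAbelianHodge :=
  HC_CM_of_abelianSchemeVHC (CorCM.AndreWeakForm.andre1992_weak_of_riemann hR) hD hanc hV

/-- **I (M) modulo Riemann's theorem** — Milne's endnote-19 theorem `VHC ⟹ HC_AV`, NO `HC_CM`, André's record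
supplied from `hR`. [cite: Deligne1982HodgeCycles, Prop. 6.1 and Milne 2003 re-edition endnote 19]
[cite: DeligneMilne1982Tannakian, §6 Thm. 6.20 (Riemann)] -/
theorem HC_AV_of_abelianSchemeVHC_of_riemann (hR : DeligneMilne1982_Thm_6_20_full)
    (hD : deligne1982_weilFamily_hodgeWeilSection_all) (hanc : AnchoredWeilFamiliesCMField)
    (hAn : MumfordTateCMAnchors) (hV : AbelianSchemeVHC) : HodgeAbelianVarieties :=
  HC_AV_of_abelianSchemeVHC (CorCM.AndreWeakForm.andre1992_weak_of_riemann hR) hD hanc hAn hV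

/-- **I (E₂) modulo Riemann's theorem**: `HC_AV ↔ AbelianSchemeVHC`. [cite: CharlesSchnell2014Notes, Cor. 11.3.6]
[cite: DeligneMilne1982Tannakian, §6 Thm. 6.20 (Riemann)] -/
theorem HC_AV_iff_abelianSchemeVHC_of_riemann (hR : DeligneMilne1982_Thm_6_20_full)
    (hD : deligne1982_weilFamily_hodgeWeilSection_all) (hanc : AnchoredWeilFamiliesCMField)
    (hAn : MumfordTateCMAnchors) : HodgeAbelianVarieties ↔ AbelianSchemeVHC :=
  HC_AV_iff_abelianSchemeVHC (CorCM.AndreWeakForm.andre1992_weak_of_riemann hR) hD hanc hAn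

/-- **I (E₃) modulo Riemann's theorem**: `(HC_CM ∧ AbelianSchemeVHC) ↔ AbelianSchemeVHC`.
[cite: Andre1996Motifs, §6.3 Remarque 2] [cite: DeligneMilne1982Tannakian, §6 Thm. 6.20 (Riemann)] -/
theorem HC_CM_and_abelianSchemeVHC_iff_of_riemann (hR : DeligneMilne1982_Thm_6_20_full)
    (hD : deligne1982_weilFamily_hodgeWeilSection_all) (hanc : AnchoredWeilFamiliesCMField) :
    (CMAbelianHodge ∧ AbelianSchemeVHC) ↔ AbelianSchemeVHC :=
  HC_CM_and_abelianSchemeVHC_iff (CorCM.AndreWeakForm.andre1992_weak_of_riemann hR) hD hanc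

/-- **III row M modulo Riemann's theorem** (anchors print-backed by `h₁₄`, Deligne Prop. 6.1).
[cite: Deligne1982HodgeCycles, Prop. 6.1 and Milne 2003 re-edition endnote 19]
[cite: DeligneMilne1982Tannakian, §6 Thm. 6.20 (Riemann)] -/
theorem HC_AV_of_abelianSchemeVHC_of_deligne1982_of_riemann (hR : DeligneMilne1982_Thm_6_20_full)
    (hD : deligne1982_weilFamily_hodgeWeilSection_all) (hanc : AnchoredWeilFamiliesCMField)
    (h₁₄ : deligne1982_exists_cmAnchoredHodgeFamily) (hV : AbelianSchemeVHC) : HodgeAbelianVarieties :=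
  HC_AV_of_abelianSchemeVHC_of_deligne1982 (CorCM.AndreWeakForm.andre1992_weak_of_riemann hR) hD hanc h₁₄ hV

/-- **III row M, exactness, modulo Riemann's theorem**: `HC_AV ↔ AbelianSchemeVHC` granted `h₁₄`.
[cite: Deligne1982HodgeCycles, Milne 2003 re-edition endnote 19] [cite: DeligneMilne1982Tannakian, §6 Thm. 6.20] -/
theorem HC_AV_iff_abelianSchemeVHC_of_deligne1982_of_riemann (hR : DeligneMilne1982_Thm_6_20_full)
    (hD : deligne1982_weilFamily_hodgeWeilSection_all) (hanc : AnchoredWeilFamiliesCMField)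
    (h₁₄ : deligne1982_exists_cmAnchoredHodgeFamily) : HodgeAbelianVarieties ↔ AbelianSchemeVHC :=
  HC_AV_iff_abelianSchemeVHC_of_deligne1982 (CorCM.AndreWeakForm.andre1992_weak_of_riemann hR) hD hanc h₁₄

/-- **XIV §A modulo Riemann's theorem**: the third kernel path to `CMIdle (1)`.
[cite: Deligne1982HodgeCycles, Milne 2003 re-edition endnote 19] [cite: DeligneMilne1982Tannakian, §6 Thm. 6.20] -/
theorem cmIdle_abelianSchemeVHC_of_milne_of_riemann (hR : DeligneMilne1982_Thm_6_20_full)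
    (hD : deligne1982_weilFamily_hodgeWeilSection_all) (hanc : AnchoredWeilFamiliesCMField)
    (h₁₄ : deligne1982_exists_cmAnchoredHodgeFamily) : CMIdle AbelianSchemeVHC :=
  cmIdle_abelianSchemeVHC_of_milne (CorCM.AndreWeakForm.andre1992_weak_of_riemann hR) hD hanc h₁₄

/-- **XIV §B modulo Riemann's theorem**: granted AO⁺, `hF`, `hR` and spread-1's densely-anchored Weil-family inputs
DA_q, DA_K, `HC_CM` is IDLE next to IC_MT (André's record, consumed inside spread-1's `AbelianAll.cmIdle_spreadZD`,
supplied from `hR`). [cite: Abdulali1994FamiliesAV, Thm. 6.1 (a)] [cite: DeligneMilne1982Tannakian, §6 Thm. 6.20] -/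
theorem cmIdle_invariantCyclesOnMTFamilies_of_aoDense_of_denselyAnchored_of_riemann
    (hAO : ZariskiDenseCMLocusIsDense) (hF : deligne1982_cmDenseMumfordTateFamilies)
    (hR : DeligneMilne1982_Thm_6_20_full) (hDq : DenselyAnchoredWeilFamiliesImaginaryQuadratic)
    (hDcm : DenselyAnchoredWeilFamiliesCMField) :
    CMIdle
      (∀ (A : AbelianVariety ℂ) (p : ℕ) (c : complexBetti A.X (2 * p)) (𝒳 S : SchemeOver ℂ) (f : 𝒳 ⟶ S),
        IsCMDenseMumfordTateFamilyFor A p c f → InvariantCyclesHoldFor f A.dim) :=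
  cmIdle_invariantCyclesOnMTFamilies_of_aoDense_of_denselyAnchored hAO hF
    (CorCM.AndreWeakForm.andre1992_weak_of_riemann hR) hDq hDcm

/-- **XIV §P modulo Riemann's theorem**: IC_MT is a PIVOT granted AO⁺, `hF`, `hR`, DA_q, DA_K.
[cite: Abdulali1994FamiliesAV, Thm. 6.1 (a)] [cite: DeligneMilne1982Tannakian, §6 Thm. 6.20 (Riemann)] -/
theorem pivotAV_invariantCyclesOnMTFamilies_of_aoDense_of_denselyAnchored_of_riemann
    (hAO : ZariskiDenseCMLocusIsDense) (hF : deligne1982_cmDenseMumfordTateFamilies)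
    (hR : DeligneMilne1982_Thm_6_20_full) (hDq : DenselyAnchoredWeilFamiliesImaginaryQuadratic)
    (hDcm : DenselyAnchoredWeilFamiliesCMField) :
    PivotAV
      (∀ (A : AbelianVariety ℂ) (p : ℕ) (c : complexBetti A.X (2 * p)) (𝒳 S : SchemeOver ℂ) (f : 𝒳 ⟶ S),
        IsCMDenseMumfordTateFamilyFor A p c f → InvariantCyclesHoldFor f A.dim) :=
  pivotAV_invariantCyclesOnMTFamilies_of_aoDense_of_denselyAnchored hAO hF
    (CorCM.AndreWeakForm.andre1992_weak_of_riemann hR) hDq hDcm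

/-- **XIV §P modulo Riemann's theorem**: (1) is a pivot by the third input set, André's record supplied from `hR`.
[cite: Deligne1982HodgeCycles, Milne 2003 re-edition endnote 19] [cite: DeligneMilne1982Tannakian, §6 Thm. 6.20] -/
theorem pivotAV_abelianSchemeVHC_of_milne_of_riemann (hR : DeligneMilne1982_Thm_6_20_full)
    (hD : deligne1982_weilFamily_hodgeWeilSection_all) (hanc : AnchoredWeilFamiliesCMField)
    (h₁₄ : deligne1982_exists_cmAnchoredHodgeFamily) : PivotAV AbelianSchemeVHC :=
  pivotAV_abelianSchemeVHC_of_milne (CorCM.AndreWeakForm.andre1992_weak_of_riemann hR) hD hanc h₁₄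

/-- **XIX §3 modulo Riemann's theorem**: part I's field-typed inputs imply spread-1's eigen-typed input DA_eig,
granted (1), `hF` and `hR`. [cite: Deligne1982HodgeCycles, Thm. 4.8 and Prop. 6.1] [cite: DeligneMilne1982Tannakian,
§6 Thm. 6.20 (Riemann)] -/
theorem denselyAnchoredEigen_of_riemann_of_rungInputs_of_abelianSchemeVHC
    (hF : deligne1982_cmDenseMumfordTateFamilies) (hR : DeligneMilne1982_Thm_6_20_full)
    (hDfam : deligne1982_weilFamily_hodgeWeilSection_all) (hanc : AnchoredWeilFamiliesCMField)
    (hV : AbelianSchemeVHC) : DenselyAnchoredEigenWeilClassesCM :=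
  denselyAnchoredEigen_of_andre_of_rungInputs_of_abelianSchemeVHC hF
    (CorCM.AndreWeakForm.andre1992_weak_of_riemann hR) hDfam hanc hV

/-! ## §2 Sharper, by the field-only form: Deligne's tensor-anchored Weil families (Thm. 4.8) are MOOT modulo `hR` -/

/-- **(D″) `HC_CM` from blanket VHC for abelian schemes granted the open anchored leaf R3anc and Riemann's theorem
ONLY** — no André record, no Deligne Thm. 4.8 families: (1) and R3anc give the CM-field rung R3 (part I
`weilClassesCMField_of_anchored_of_abelianSchemeVHC`), and R3 alone gives `HC_CM` modulo `hR` (cell pub-hodgecm2's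
`CorCM.AndreWeakForm.hc_cm_of_riemann_of_weilClassesCMField`: the common Galois CM field of the dominating product has
degree `> 2`, so the imaginary-quadratic rung R∞ is never consumed). Implies I (D) and §1's re-base of it.
(Rev 2 note, docstring-only: `hR` is now supplied by the tree theorem
`HodgeTheory.deligneMilne1982_Thm_6_20_full_holds`, so at that term this row reads `R3anc → AbelianSchemeVHC → HC_CM`,
FACT-FREE — see the module docstring.)
[cite: Andre1992HodgeCM, p. 2 and Théorème] [cite: DeligneMilne1982Tannakian, §6 Thm. 6.20 (Riemann)]
[cite: Andre1996Motifs, §6.3 Lemme 6.3.3] [cite: Markman2025SurveySecant, Thm. 1.4] -/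
theorem HC_CM_of_anchored_of_abelianSchemeVHC_of_riemann (hR : DeligneMilne1982_Thm_6_20_full)
    (hanc : AnchoredWeilFamiliesCMField) (hV : AbelianSchemeVHC) : CMAbelianHodge :=
  CorCM.AndreWeakForm.hc_cm_of_riemann_of_weilClassesCMField hR
    (weilClassesCMField_of_anchored_of_abelianSchemeVHC hanc hV)

/-- **(M″) Milne's endnote-19 theorem `VHC ⟹ HC_AV` granted R3anc, `MTAnchors` and Riemann's theorem only** — NO
`HC_CM`, no André record, no Thm. 4.8 families: (D″) then part I (V). [cite: Deligne1982HodgeCycles, Prop. 6.1 and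
Milne 2003 re-edition endnote 19] [cite: DeligneMilne1982Tannakian, §6 Thm. 6.20 (Riemann)] -/
theorem HC_AV_of_anchored_of_abelianSchemeVHC_of_riemann (hR : DeligneMilne1982_Thm_6_20_full)
    (hanc : AnchoredWeilFamiliesCMField) (hAn : MumfordTateCMAnchors) (hV : AbelianSchemeVHC) :
    HodgeAbelianVarieties :=
  HC_AV_of_HC_CM_and_abelianSchemeVHC (HC_CM_of_anchored_of_abelianSchemeVHC_of_riemann hR hanc hV) hAn hV

/-- **(E₂″) `HC_AV ↔ AbelianSchemeVHC` granted R3anc, `MTAnchors` and Riemann's theorem only.**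
[cite: CharlesSchnell2014Notes, Cor. 11.3.6] [cite: DeligneMilne1982Tannakian, §6 Thm. 6.20 (Riemann)] -/
theorem HC_AV_iff_abelianSchemeVHC_of_anchored_of_riemann (hR : DeligneMilne1982_Thm_6_20_full)
    (hanc : AnchoredWeilFamiliesCMField) (hAn : MumfordTateCMAnchors) :
    HodgeAbelianVarieties ↔ AbelianSchemeVHC :=
  ⟨abelianSchemeVHC_of_HC_AV, HC_AV_of_anchored_of_abelianSchemeVHC_of_riemann hR hanc hAn⟩

/-- **(E₃″) What `HC_CM` is worth next to blanket VHC, granted R3anc and Riemann's theorem: nothing** —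
`(HC_CM ∧ AbelianSchemeVHC) ↔ AbelianSchemeVHC`, binding ONE record (`hR`) and ONE open leaf (R3anc).
(Rev 2 note, docstring-only: at the tree theorem `HodgeTheory.deligneMilne1982_Thm_6_20_full_holds` the record is
discharged and the row binds R3anc alone.)
[cite: Andre1996Motifs, §6.3 Remarque 2] [cite: DeligneMilne1982Tannakian, §6 Thm. 6.20 (Riemann)] -/
theorem HC_CM_and_abelianSchemeVHC_iff_of_anchored_of_riemann (hR : DeligneMilne1982_Thm_6_20_full)
    (hanc : AnchoredWeilFamiliesCMField) : (CMAbelianHodge ∧ AbelianSchemeVHC) ↔ AbelianSchemeVHC :=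
  ⟨fun h ↦ h.2, fun hV ↦ ⟨HC_CM_of_anchored_of_abelianSchemeVHC_of_riemann hR hanc hV, hV⟩⟩

/-- **III row M granted R3anc, `h₁₄` and Riemann's theorem only** (anchors print-backed: Deligne Prop. 6.1 via part
III `mumfordTateCMAnchors_of_deligne1982_exists_cmAnchored`). [cite: Deligne1982HodgeCycles, Prop. 6.1 and Milne 2003
re-edition endnote 19] [cite: DeligneMilne1982Tannakian, §6 Thm. 6.20 (Riemann)] -/
theorem HC_AV_of_anchored_of_abelianSchemeVHC_of_deligne1982_of_riemann (hR : DeligneMilne1982_Thm_6_20_full)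
    (hanc : AnchoredWeilFamiliesCMField) (h₁₄ : deligne1982_exists_cmAnchoredHodgeFamily) (hV : AbelianSchemeVHC) :
    HodgeAbelianVarieties :=
  HC_AV_of_anchored_of_abelianSchemeVHC_of_riemann hR hanc (mumfordTateCMAnchors_of_deligne1982_exists_cmAnchored h₁₄) hV

/-- **III row M, exactness, granted R3anc, `h₁₄` and Riemann's theorem only**: `HC_AV ↔ AbelianSchemeVHC`.
[cite: Deligne1982HodgeCycles, Milne 2003 re-edition endnote 19] [cite: DeligneMilne1982Tannakian, §6 Thm. 6.20] -/
theorem HC_AV_iff_abelianSchemeVHC_of_anchored_of_deligne1982_of_riemann (hR : DeligneMilne1982_Thm_6_20_full)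
    (hanc : AnchoredWeilFamiliesCMField) (h₁₄ : deligne1982_exists_cmAnchoredHodgeFamily) :
    HodgeAbelianVarieties ↔ AbelianSchemeVHC :=
  HC_AV_iff_abelianSchemeVHC_of_anchored_of_riemann hR hanc (mumfordTateCMAnchors_of_deligne1982_exists_cmAnchored h₁₄)

/-- **XIV §A granted R3anc, `h₁₄` and Riemann's theorem only**: `CMIdle (1)`.
[cite: Deligne1982HodgeCycles, Milne 2003 re-edition endnote 19] [cite: DeligneMilne1982Tannakian, §6 Thm. 6.20] -/
theorem cmIdle_abelianSchemeVHC_of_anchored_of_riemann (hR : DeligneMilne1982_Thm_6_20_full)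
    (hanc : AnchoredWeilFamiliesCMField) (h₁₄ : deligne1982_exists_cmAnchoredHodgeFamily) :
    CMIdle AbelianSchemeVHC :=
  fun hV ↦ HC_AV_of_anchored_of_abelianSchemeVHC_of_deligne1982_of_riemann hR hanc h₁₄ hV

/-- **XIV §P granted R3anc, `h₁₄` and Riemann's theorem only**: (1) is a PIVOT (`CMIdle` above, `OnPathAV` frame I).
[cite: Deligne1982HodgeCycles, Milne 2003 re-edition endnote 19] [cite: DeligneMilne1982Tannakian, §6 Thm. 6.20] -/
theorem pivotAV_abelianSchemeVHC_of_anchored_of_riemann (hR : DeligneMilne1982_Thm_6_20_full)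
    (hanc : AnchoredWeilFamiliesCMField) (h₁₄ : deligne1982_exists_cmAnchoredHodgeFamily) :
    PivotAV AbelianSchemeVHC :=
  ⟨cmIdle_abelianSchemeVHC_of_anchored_of_riemann hR hanc h₁₄,
    AbelianAll.onPathAV_abelianSchemeVHC_and_compactAbelianPencilVHC.1⟩

/-- **XIX §3 granted (1), R3anc, `hF` and Riemann's theorem only**: the field-typed inputs imply spread-1's
eigen-typed DA_eig — `[hR, R3anc] ⟹[(1), hF] DA_eig` (through `HC_CM` by (D″), then spread X on-path).
[cite: Deligne1982HodgeCycles, Prop. 6.1] [cite: DeligneMilne1982Tannakian, §6 Thm. 6.20 (Riemann)] -/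
theorem denselyAnchoredEigen_of_riemann_of_anchored_of_abelianSchemeVHC
    (hF : deligne1982_cmDenseMumfordTateFamilies) (hR : DeligneMilne1982_Thm_6_20_full)
    (hanc : AnchoredWeilFamiliesCMField) (hV : AbelianSchemeVHC) : DenselyAnchoredEigenWeilClassesCM :=
  denselyAnchoredEigen_of_deligne1982_of_HC_CM hF (HC_CM_of_anchored_of_abelianSchemeVHC_of_riemann hR hanc hV)

end Summit.HodgeConjecture.HodgeConjecture.Ring2.Deform

end
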